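import Mathlib.Algebra.ContinuedFractions.Computation.Basic
import Mathlib.Analysis.SpecialFunctions.Exp
import Mathlib.Analysis.SpecialFunctions.Log.Basic
import Mathlib.Data.Set.Finite.Basic
import HarnessLib

/-!
# The regular continued fraction of `e` (Euler 1737) and Davis's approximation measure (1978)

Topic: `Literature/NumberTheory/DiophantineApproximation`. NAMED FACTS (CONVENTIONS §4: a
published result vendored as `def … : Prop`; users take `(h : <Fact>)`), vendored to ground the
sector route `Schanuel/MoebiusRung` (`Summits/Schanuel/Schanuel/Theses/MoebiusRung.lean`):

* `EulerContFractExpOne` — Euler's expansion `e = [2; 1, 2, 1, 1, 4, 1, 1, 6, 1, …]`, printed as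
  "The continued fraction of e is `e = 2 + 1/(1+) 1/(2+) 1/(1+) 1/(1+) 1/(4+) 1/(1+) 1/(1+)
  1/(6+) 1/(1+) …`" [Angell2021, Thm 4.22] with, in its proof, "the partial quotients … are
  `a_m = 2k` if `m = 3k − 1`, `1` otherwise"; also "Theorem 1. `e = [1,0,1,1,2,1,1,4,1,1,6,1,1,8,
  1,1,10,1,…]`", equivalently `[2,1,2,1,1,4,1,1,6,1,1,8,…]` [Cohn2006, Thm 1 and §1]. It grounds
  `Summit.Schanuel.Schanuel.Theses.MoebiusRung.EulerContinuedFraction` (IDENTICAL statement: the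
  item is `fun h => h`).
* `Davis1978_thm1` — C. S. Davis, *Rational approximations to e*, J. Austral. Math. Soc. A 25
  (1978) 497–502, Theorem 1 (p. 498): for every `ε > 0` the inequality
  `|e − p/q| < (½ + ε) log log q / (q² log q)` has infinitely many solutions in integers `p, q`,
  and there is `q' = q'(ε)` with `|e − p/q| > (½ − ε) log log q / (q² log q)` for all integers
  `p, q` with `q ≥ q'` ("the greatest lower bound (in fact ½) is found of constants k such that
  `|e − p/q| < k log log q/(q² log q)` for an infinity of rationals p/q", Abstract). It grounds
  `Summit.Schanuel.Schanuel.Theses.MoebiusRung.ExpOneLogApproxFinite` (item = fact ∘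
  specialisation: `ε := 1/4`; for `q ≥ max (q', exp (exp (4C)))` one has
  `(¼) log log q ≥ C`, so `{q | ∃ p, |e − p/q| < C/(q² log q)}` is bounded, hence finite).

## Indexing conventions (Mathlib `GenContFract.of`)

For a real `v` with regular continued fraction `[a₀; a₁, a₂, …]`, `(GenContFract.of v).h = ⌊v⌋
= a₀` and `(GenContFract.of v).partDens.get? n = some a_{n+1}` (the stream of partial
denominators starts at `a₁`). Hence Euler's pattern `a_m = 2k (m = 3k − 1), 1 otherwise`
(`m ≥ 1`) reads, with `n = m − 1`: `partDens n = 2(⌊n/3⌋ + 1)` if `n ≡ 1 (mod 3)`, else `1`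
(check: `n = 1 ↦ a₂ = 2`, `n = 4 ↦ a₅ = 4`, `n = 7 ↦ a₈ = 6`).

## Junk-value audit

In `Davis1978_thm1`, `q : ℕ` ranges over all naturals but `q = 0, 1` never solve (1):
`Real.log 0 = Real.log 1 = 0` makes the right-hand side `0`, and `|e − p/q| ≥ 0`; part (2) is
guarded by `q₀ ≤ q`. "Infinitely many solutions `(p, q)`" is rendered as "infinitely many `q`
admitting some `p`" (for each `q` at most finitely many `p` can solve (1), so the two are
equivalent).

What is NOT here: Hurwitz's 1896 closure theorem for continued fractions whose partial
quotients are interlaced arithmetic progressions (source not yet readable on this hub: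
acquisition requests acq-02492, acq-02469); any proof (these are `literature-prover` targets:
Cohn's six-integral proof is ~1 page).
-/

namespace Literature.NumberTheory.DiophantineApproximation

/-- **Euler's continued fraction of `e`** (Euler 1737, *De fractionibus continuis*; short proof:
Cohn 2006). `e = [2; 1, 2, 1, 1, 4, 1, 1, 6, 1, 1, 8, …]`: the integer part is `2` and the `m`-th
partial quotient (`m ≥ 1`) is `2k` if `m = 3k − 1` and `1` otherwise — in Mathlib's 0-based
`partDens` (index `n = m − 1`): `2(⌊n/3⌋ + 1)` if `n % 3 = 1`, else `1`. NAMED FACT, not proved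
here; identical to the route item `Summit.Schanuel.Schanuel.Theses.MoebiusRung.EulerContinuedFraction`
(stmt-Schanuel-5875), which it grounds. [cite: Angell2021, Thm 4.22] -/
def EulerContFractExpOne : Prop :=
  (GenContFract.of (Real.exp 1)).h = 2 ∧
    ∀ n : ℕ, (GenContFract.of (Real.exp 1)).partDens.get? n =
      some (if n % 3 = 1 then ((2 * (n / 3 + 1) : ℕ) : ℝ) else 1)

/-- **Davis 1978, Theorem 1** (the exact approximation measure of `e`): "For any `ε > 0` there is
an infinity of solutions of the inequality `|e − p/q| < (½ + ε) log log q / (q² log q)` in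
integers `p, q`. Further, there exists a number `q' = q'(ε)` such that
`|e − p/q| > (½ − ε) log log q / (q² log q)` for all integers `p, q` with `q ≥ q'`." NAMED FACT,
not proved here (proof in print: explicit convergents `P_n/Q_n` from Hermite–Padé integrals,
`log Q_n ~ n log n`, Legendre's criterion). Grounds the route item
`Summit.Schanuel.Schanuel.Theses.MoebiusRung.ExpOneLogApproxFinite` (stmt-Schanuel-5876) by the
specialisation `ε := 1/4` (the item is the weak, constant-free corollary: for every `C` only
finitely many `q` admit `p` with `|e − p/q| < C/(q² log q)`). [cite: Davis1978, Thm 1 (p. 498)] -/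
def Davis1978_thm1 : Prop :=
  ∀ ε : ℝ, 0 < ε →
    {q : ℕ | ∃ p : ℤ, |Real.exp 1 - p / q| <
        (1 / 2 + ε) * Real.log (Real.log q) / ((q : ℝ) ^ 2 * Real.log q)}.Infinite ∧
    ∃ q₀ : ℕ, ∀ (p : ℤ) (q : ℕ), q₀ ≤ q →
        (1 / 2 - ε) * Real.log (Real.log q) / ((q : ℝ) ^ 2 * Real.log q) < |Real.exp 1 - p / q|

end Literature.NumberTheory.DiophantineApproximation
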